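import Summits.BirchSwinnertonDyer.BirchSwinnertonDyer.Theorems.ThetaPartnerAtTwoSignedControlAtTwoMuRealKummer
import Summits.BirchSwinnertonDyer.BirchSwinnertonDyer.Theorems.SchneiderFreeAdditiveX3PoitouTateMuLevelMiddleExact
import Summits.BirchSwinnertonDyer.BirchSwinnertonDyer.Theorems.SchneiderFreeAdditiveX3PoitouTateUnramifiedOrthogonalAllLevels
import Literature.NumberTheory.GaloisCohomology.BrauerSumInvCyclicClass
import Literature.NumberTheory.GaloisCohomology.PoitouTateNumberField
import HarnessLib

/-!
# Milne *ADT* I Thm. 4.10(b) `Ker γ¹ ⊆ Im β¹` for `M = μₙ` at EVERY level `n` over EVERY number field —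
# the REAL places included (no parity hypothesis on `n`)

Route `ThetaPartnerAtTwo`, crux K4 `SignedControlAtTwo` (stmt-BirchSwinnertonDyer-20309), line `eulerchar` v10, lead
`bsd-wall-tp2-p3` g4 (`--supports stmt-BirchSwinnertonDyer-20309`, helper).  WHY HERE: the registered stub of K4 is
`Cassels ∧ Prop 4.12 ∧ poitouTate_selmerStructure_duality ℚ`; K4 lives at `p = 2` over `ℚ`, a field WITH a real place,
and every middle-exactness theorem of the tree's Poitou–Tate toolkit (cells bsd-schneider / bsd-stepL:
`middleExact_mu_level`, `middleExact_canonical_trivial_level`, `middleExact_canonical_of_card_eq_sq`, …) carries the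
archimedean hypothesis `∀ w, w.IsReal → Odd n`.  This file (2/2; archimedean Kummer inputs in `…MuRealKummer`:
`exists_forall_localization_δ₀_eq_of_signs`, `exists_unit_sign_localization_inl_δ₀_eq`,
`localization_inl_kummer_eq_of_eq_mul_pow`) removes it in the base case `M = μₙ`:

* **`middleExact_mu_level_real`** — Milne I 4.10(b) `Ker γ¹ ⊆ Im β¹` for `ρ = mu K n`, THE invariant maps
  `LocalInvariants.canonical K n`, every `n ≥ 1`, every number field `K`, `S ⊇ {v ∣ ∞}`: the statement of
  `middleExact_mu_level` WITHOUT `harch`.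

Proof of the last (Tate, Cassels–Fröhlich VII §5.1 / §10; Milne I 4.10): as in `middleExact_mu_level` — Kummer
half `t = loc κₙ(b)` on `S` (now including the real places, by the first two items), then the class-field half for
the idèle `ξ = ∏_{v ∈ S_f} ⟨b⟩_v · (b)_∞` (archimedean components KEPT): for a faithful class-field character `χ` of
exponent `n` unramified off `S_f` with cyclic character `ψ` of level `d ∣ n`, the RECIPROCITY LAW
`∑_v inv_v (loc_v (κₙ(b) ∪ Ψ_*[ψ])) = 0` (`sumInvLocalizationEqZero_canonical_of_numberField`, all places, real ones
included) turns the orthogonality hypothesis on `S` into `∑_{v ∈ T} ψ(σ_v) = 0` over the finite places `T` off `S_f`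
where `b` is not a unit (the terms off `S ∪ T` vanish by Milne I 2.6 for THE maps,
`unramifiedOrthogonal_of_isPerfect_allLevels`), and the principal idèle `(b) = ξ · ∏_{v ∈ T ∪ …} ⟨b⟩_v · u`
(`principalIdele_mem_mul_unitIdelesOutside`, `ψ_{L|K}((b)) = 1`) gives `χ(ψ_{L|K} ξ) = 1`.  So NO archimedean
cup-product evaluation is needed; the real places enter only through `ξ_∞ = (b)_∞`, which pins the SIGNS of the
global representative `a₀` (`ξ = (a₀)·u·yⁿ`, `u_∞ = 1`) and hence `loc_w κₙ(a₀) = loc_w κₙ(b) = t_w`.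

HONEST FRAMING. THEOREMS ONLY (no definition, no named fact, no instance, no sorry).  This is ONE module (`μₙ`) of
the `∀ M` statement `poitouTate_selmerStructure_duality`; it closes no item; BSD is not proved by any of this.

References: [MilneADT2006] I Thm. 4.10(b), Thm. 2.6, Ex. 1.6 (c); [CasselsFrohlichANT1967] II §6 (weak approximation),
VII §5.1, §10; [SerreLocalFields1979] X §3, XIV §1; [NeukirchANT1999] VI §5 (5.6).
-/

noncomputable section

open CategoryTheory Function NumberField IsDedekindDomain Field ValuativeRel
open scoped NumberField ContRepresentation Topology

set_option linter.dupNamespace false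
set_option autoImplicit false

namespace Summit.BirchSwinnertonDyer.BirchSwinnertonDyer.Theorems.SignedEC.MuReal

open _root_.ContinuousCohomology
open Literature.NumberTheory.GaloisRepresentations
open Literature.NumberTheory.GaloisRepresentations.DiscreteGaloisModule
open Literature.NumberTheory.GaloisRepresentations.IsNonarchimedeanLocalField
open Literature.NumberTheory.GaloisCohomology
open Literature.NumberTheory.NumberFields
open Literature.AnabelianGeometry.AbsoluteAnabelian
open Literature.AnabelianGeometry.AbsoluteAnabelian.Prop121vii
open _root_.TopRep _root_.ContRepresentation
open Summit.BirchSwinnertonDyer.Rank1Residual.X11b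
open Summit.BirchSwinnertonDyer.Rank1Residual.JET.GlobalDuality
open Summit.BirchSwinnertonDyer.BirchSwinnertonDyer.Theorems.SchneiderFreeAdditiveX3.PoitouTateReduction

variable {K : Type} [Field K] [NumberField K] {n : ℕ} [NeZero n]

/-! ## §3. Milne I Thm. 4.10(b) for `μₙ`, every level, every number field, real places included -/

/-- **Milne *ADT* I Thm. 4.10(b) `Ker γ¹ ⊆ Im β¹` for `M = μₙ` at EVERY level `n ≥ 1` over EVERY number field `K`,
THE invariant maps `LocalInvariants.canonical K n`, the REAL places included** — `middleExact_mu_level` WITHOUT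
its archimedean hypothesis `∀ w, w.IsReal → Odd n`.  For a finite set `S` of places containing the infinite ones,
with `n ∉ v` for the finite `v ∉ S`, every family of local classes `t_v ∈ H¹(K_v, μₙ)` (`v ∈ S`, real places
included) which is orthogonal, under the sum over `S` of the local Tate pairings of THE invariant maps, to every
class of `H¹(K, μₙ^D)` unramified outside `S`, is the localisation on `S` of a global class `x ∈ H¹(K, μₙ)`
unramified outside `S`.  See the module docstring for the proof (Kummer half with signs; class-field half via the
reciprocity law, the principal idèle of `b` and Tate's `Kˣ · U^S · 𝕀ⁿ` separation).
[cite: MilneADT2006, Ch. I, Thm. 4.10(b), Thm. 2.6] [cite: CasselsFrohlichANT1967, Ch. VII §5.1 Main Theorem (B), (D), §10]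
[cite: SerreLocalFields1979, XIV §1 Prop. 3] -/
theorem middleExact_mu_level_real
    (S : Finset (Place K)) (hinf : ∀ w : InfinitePlace K, (Sum.inl w : Place K) ∈ S)
    (hS : ∀ v : HeightOneSpectrum (𝓞 K), (Sum.inr v : Place K) ∉ S →
      ((n : ℕ) : 𝓞 K) ∉ v.asIdeal ∧ GaloisRep.IsUnramifiedAt v (mu K n))
    (t : Π v : Place K, galoisCohomology ((mu K n).toLocal v) 1)
    (horth : ∀ y : galoisCohomology ((mu K n).tateDual n) 1,
      (∀ v : HeightOneSpectrum (𝓞 K), (Sum.inr v : Place K) ∉ S →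
        galoisCohomology.localization ((mu K n).tateDual n) (Sum.inr v) 1 y ∈
          unramifiedSubgroup (GaloisRep.toLocal v ((mu K n).tateDual n)) 1) →
      ∑ v ∈ S, localTatePairingZMod (mu K n) n v (LocalInvariants.canonical K n v) (t v)
        (galoisCohomology.localization ((mu K n).tateDual n) v 1 y) = 0) :
    ∃ x : galoisCohomology (mu K n) 1,
      (∀ v : HeightOneSpectrum (𝓞 K), (Sum.inr v : Place K) ∉ S →
        galoisCohomology.localization (mu K n) (Sum.inr v) 1 x ∈
          unramifiedSubgroup (GaloisRep.toLocal v (mu K n)) 1) ∧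
      ∀ v ∈ S, galoisCohomology.localization (mu K n) v 1 x = t v := by
  classical
  -- no real place: the toolkit's theorem applies verbatim
  by_cases hreal : ∃ w : InfinitePlace K, w.IsReal
  swap
  · exact middleExact_mu_level (fun w hw => absurd ⟨w, hw⟩ hreal) S hinf hS t horth
  obtain ⟨w₀, hw₀⟩ := hreal
  haveI : CompactSpace (absoluteGaloisGroup K) := absoluteGaloisGroup_compactSpace K
  haveI : Finite (MuCarrier K n) := Literature.NumberTheory.GaloisRepresentations.finite_muCarrier K n
  set hR := artinReciprocity_character_holds
  have hUO : (LocalInvariants.canonical K n).UnramifiedOrthogonal :=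
    unramifiedOrthogonal_of_isPerfect_allLevels _ LocalInvariants.canonical_isPerfect
  have hMn : ∀ m : MuCarrier K n, n • m = 0 := mu_nsmul_eq_zero_level
  -- the finite places of `S`
  set Sf : Finset (HeightOneSpectrum (𝓞 K)) := S.toRight with hSf
  have hmemSf : ∀ v, v ∈ Sf ↔ (Sum.inr v : Place K) ∈ S := fun v => by rw [hSf, Finset.mem_toRight]
  -- §1. Kummer half, real places included: `t_v = loc_v κ(b)` on ALL of `S`
  have harch : ∀ w : InfinitePlace K, ∃ (e : K) (he : e ≠ 0), (e = 1 ∨ e = -1) ∧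
      galoisCohomology.localization (mu K n) (Sum.inl w) 1
        ((isSES_kummer K n (NeZero.pos n)).δ₀ (baseUnitsInvariant K e he)) = t (Sum.inl w) :=
    fun w => exists_unit_sign_localization_inl_δ₀_eq w (t (Sum.inl w))
  choose e he0 he1 het using harch
  set N : Set (InfinitePlace K) := {w | e w = -1} with hN
  obtain ⟨b, hb0, hbneg, hbpos, hbt⟩ :=
    exists_forall_localization_δ₀_eq_of_signs (n := n) Sf (fun v => t (Sum.inr v)) N hw₀
  have hee : ∀ w, e w * e w = 1 := fun w => by rcases he1 w with h1 | h1 <;> simp [h1]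
  have hbt_inf : ∀ w : InfinitePlace K, galoisCohomology.localization (mu K n) (Sum.inl w) 1
      ((isSES_kummer K n (NeZero.pos n)).δ₀ (baseUnitsInvariant K b hb0)) = t (Sum.inl w) := by
    intro w
    rw [← het w]
    -- `b = e_w · sⁿ` in `K_w`
    obtain ⟨s, hs⟩ : ∃ s : w.Completion,
        algebraMap K w.Completion b = algebraMap K w.Completion (e w) * s ^ n := by
      have hrew : ∀ s : w.Completion, algebraMap K w.Completion (b * e w) = s ^ n →
          algebraMap K w.Completion b = algebraMap K w.Completion (e w) * s ^ n := fun s hs => by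
        rw [← hs, ← map_mul, mul_comm b, ← mul_assoc, hee, one_mul]
      rcases w.isReal_or_isComplex with hw | hw
      · have hpos : 0 < InfinitePlace.Completion.extensionEmbeddingOfIsReal hw
            (algebraMap K w.Completion (b * e w)) := by
          rcases he1 w with h1 | h1
          · have hwN : w ∉ N := by
              change ¬ (e w = -1); rw [h1]; norm_num
            rw [h1, mul_one]; exact hbpos w hw hwN
          · have hwN : w ∈ N := h1
            rw [h1, mul_neg_one, map_neg, map_neg]
            exact neg_pos.mpr (hbneg w hw hwN)
        obtain ⟨s, hs⟩ := exists_pow_eq_of_pos (n := n) hw _ hpos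
        exact ⟨s, hrew s hs⟩
      · obtain ⟨s, hs⟩ := exists_pow_eq_of_isComplex (n := n) hw (NeZero.pos n)
          (algebraMap K w.Completion (b * e w))
        exact ⟨s, hrew s hs⟩
    exact localization_inl_kummer_eq_of_eq_mul_pow w (e w) b (he0 w) hb0 hs
  have hbt_all : ∀ v ∈ S, galoisCohomology.localization (mu K n) v 1
      ((isSES_kummer K n (NeZero.pos n)).δ₀ (baseUnitsInvariant K b hb0)) = t v := by
    rintro (w | v) hv
    · exact hbt_inf w
    · exact hbt v ((hmemSf v).mpr hv)
  set bu : Kˣ := Units.mk0 b hb0 with hbu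
  have hκb : (isSES_kummer K n (NeZero.pos n)).δ₀ (baseUnitsInvariant K (bu : K) bu.ne_zero) =
      (isSES_kummer K n (NeZero.pos n)).δ₀ (baseUnitsInvariant K b hb0) := rfl
  -- §2. the idèle `ξ = ∏_{v ∈ Sf} ⟨b⟩_v · (b)_∞` (archimedean components KEPT)
  set ξf : ideleGroup K := ∏ v ∈ Sf, localUnits v (globalToLocalUnits v bu) with hξf
  set ξ : ideleGroup K := ξf * infiniteIdeles K (globalToInfiniteUnits K bu) with hξ
  have hξsnd : ∀ v, (ξ : AdeleRing (𝓞 K) K).2 v =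
      if v ∈ Sf then algebraMap K (v.adicCompletion K) b else 1 := by
    intro v
    rw [hξ, ideleGroup_val_snd_mul, infiniteIdeles_snd, mul_one, hξf, snd_prod_localUnits]
    split_ifs <;> simp [val_globalToLocalUnits, hbu]
  have hξfst : (ξ : AdeleRing (𝓞 K) K).1 = algebraMap K (InfiniteAdeleRing K) b := by
    rw [hξ, ideleGroup_val_fst_mul, hξf, fst_prod_localUnits, one_mul, infiniteIdeles_fst,
      val_globalToInfiniteUnits, hbu, Units.val_mk0]
  -- Weil-group lifts of `b` at the finite places
  have hlift : ∀ v : HeightOneSpectrum (𝓞 K), ∃ w : WeilGroup (v.adicCompletion K),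
      canonicalArtin (v.adicCompletion K) w = globalToLocalUnits v bu := fun v =>
    (isLocalArtinMap_canonicalArtin_holds (v.adicCompletion K)).isOpenQuotientMap_artin.surjective _
  choose wv hwv using hlift
  -- the finite places off `Sf` where `b` is not a unit
  set T : Finset (HeightOneSpectrum (𝓞 K)) :=
    (finite_setOf_valued_ne_one bu).toFinset.filter (fun v => v ∉ Sf) with hT
  have hmemT : ∀ v, v ∈ T ↔ Valued.v (algebraMap K (v.adicCompletion K) b) ≠ 1 ∧ v ∉ Sf := fun v => by
    rw [hT, Finset.mem_filter, Set.Finite.mem_toFinset]; rfl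
  have hunit_of : ∀ v : HeightOneSpectrum (𝓞 K), v ∉ Sf → v ∉ T →
      Valued.v (algebraMap K (v.adicCompletion K) b) = 1 := fun v hvS hvT => by
    by_contra h; exact hvT ((hmemT v).mpr ⟨h, hvS⟩)
  -- §3. class-field half: `ξ` is killed by every faithful character of exponent `n` unramified off `Sf`
  have hsep := exists_eq_principalIdele_mul_mul_pow_of_forall_faithful_character (n := n) Sf ξ
    fun L _ _ _ χ hinj hχn hunr => ?goal
  case goal =>
    -- local units at `v ∉ Sf` are killed by `ψ_{L|K}` (faithfulness of `χ`)
    have hunits : ∀ v : HeightOneSpectrum (𝓞 K), v ∉ Sf → ∀ u : (v.adicCompletion K)ˣ,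
        Valued.v (u : v.adicCompletion K) = 1 → artinIdeleMap L hR (localUnits v u) = 1 :=
      fun v hv u hu => hinj (by rw [map_one]; exact hunr v hv u hu)
    -- the cyclic character of `χ`, of level `d ∣ n`, `n = d · m`; the test class `y = Ψ_*[ψ·id]`
    obtain ⟨d, hdne, ζ, ψ, hζ, hker, hval, hdvd⟩ := exists_cyclicCharacter_of_injective L χ hinj
    haveI : NeZero d := hdne
    obtain ⟨m, hm⟩ := hdvd n hχn
    have h : d * m = n := hm.symm
    obtain ⟨Ψ, hΨ⟩ := exists_tateDual_muLevel_intertwining (K := K) h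
    obtain ⟨ψe, hψe_inj, hψe⟩ := exists_zmod_level_embedding d n (Dvd.intro m h)
    have hnd : n / d = m := by rw [← h, Nat.mul_div_cancel_left m (NeZero.pos d)]
    set y : galoisCohomology ((mu K n).tateDual n) 1 :=
      galoisCohomology.map Ψ 1 (oneCocycleClass _ (scalarCocycle ψ)) with hy
    have hyur : ∀ v : HeightOneSpectrum (𝓞 K), (Sum.inr v : Place K) ∉ S →
        galoisCohomology.localization ((mu K n).tateDual n) (Sum.inr v) 1 y ∈
          unramifiedSubgroup (GaloisRep.toLocal v ((mu K n).tateDual n)) 1 := fun v hv => by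
      rw [hy, show galoisCohomology.localization ((mu K n).tateDual n) (Sum.inr v) 1
          (galoisCohomology.map Ψ 1 (oneCocycleClass _ (scalarCocycle ψ))) =
        galoisCohomology.map (Ψ.restrictField (Place.Completion (Sum.inr v))) 1
          (galoisCohomology.localization ((mu K d).tateDual d) (Sum.inr v) 1 (oneCocycleClass _ (scalarCocycle ψ)))
        from galoisCohomology.res_map_one _ Ψ _]
      exact Levels.map_mem_unramifiedSubgroup _
        (localization_oneCocycleClass_scalarCocycle_mem_unramifiedSubgroup_of_forall_localUnits
          L ψ hker v (hunits v fun h' => hv ((hmemSf v).mp h')))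
    have hsum := horth y hyur
    -- the global class `c = κ(b) ∪ y` and its local invariants
    set c : galoisCohomology (mu K n) 2 := ((mu K n).tateDualPairing n).cupProduct
      ((isSES_kummer K n (NeZero.pos n)).δ₀ (baseUnitsInvariant K (bu : K) bu.ne_zero)) y with hc
    have hSterm : ∀ v ∈ S, localTatePairingZMod (mu K n) n v (LocalInvariants.canonical K n v) (t v)
        (galoisCohomology.localization ((mu K n).tateDual n) v 1 y) =
        LocalInvariants.canonical K n v (galoisCohomology.localization (mu K n) v 2 c) := by
      intro v hv
      rw [← hbt_all v hv, ← hκb, localTatePairingZMod_apply, hc, LocalInvariants.localization_cupProduct]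
    -- the term at a finite place off `Sf ∪ T` vanishes (Milne I 2.6 for THE maps)
    have hvan : ∀ v : HeightOneSpectrum (𝓞 K), v ∉ Sf → v ∉ T →
        LocalInvariants.canonical K n (Sum.inr v) (galoisCohomology.localization (mu K n) (Sum.inr v) 2 c) = 0 := by
      intro v hvS hvT
      have hvS' : (Sum.inr v : Place K) ∉ S := fun h' => hvS ((hmemSf v).mpr h')
      have hκur : galoisCohomology.localization (mu K n) (Sum.inr v) 1
          ((isSES_kummer K n (NeZero.pos n)).δ₀ (baseUnitsInvariant K (bu : K) bu.ne_zero)) ∈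
            unramifiedSubgroup (GaloisRep.toLocal v (mu K n)) 1 :=
        localization_kummer_mem_unramifiedSubgroup_of_eq_unit_mul_pow v (bu : K) bu.ne_zero (hS v hvS').1
          ⟨globalToLocalUnits v bu, 1, by rw [val_globalToLocalUnits]; exact hunit_of v hvS hvT,
            by rw [one_pow, mul_one, val_globalToLocalUnits]⟩
      have hyv := hyur v hvS'
      rw [← (hUO (mu K n) hMn v (hS v hvS').1 (hS v hvS').2).1] at hyv
      rw [hc, LocalInvariants.localization_cupProduct, ← localTatePairingZMod_apply]
      exact (LocalInvariants.mem_dualLocalCondition_iff _ _ _ _ _).mp hyv _ hκur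
    -- reciprocity over `S ∪ T`: the `T`-terms sum to zero
    set T' : Finset (Place K) := T.map ⟨Sum.inr, Sum.inr_injective⟩ with hT'
    have hdisj : Disjoint S T' := by
      rw [Finset.disjoint_left]
      rintro q hqS hqT
      obtain ⟨v, hvT, rfl⟩ := Finset.mem_map.mp hqT
      exact ((hmemT v).mp hvT).2 ((hmemSf v).mpr hqS)
    have hrec := sumInvLocalizationEqZero_canonical_of_numberField K n c (S ∪ T') (fun q hq => by
      rcases q with w | v
      · exact absurd (Finset.mem_union_left _ (hinf w)) hq
      · have hvS : v ∉ Sf := fun h' => hq (Finset.mem_union_left _ ((hmemSf v).mp h'))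
        have hvT : v ∉ T := fun h' => hq (Finset.mem_union_right _ (Finset.mem_map.mpr ⟨v, h', rfl⟩))
        exact hvan v hvS hvT)
    rw [Finset.sum_union hdisj, ← Finset.sum_congr rfl hSterm, hsum, zero_add, hT', Finset.sum_map] at hrec
    simp only [Function.Embedding.coeFn_mk] at hrec
    -- each `T`-term is `m · (-ψ(res_v w_v))` read in `ℤ/n`
    have hterm : ∀ v ∈ T, LocalInvariants.canonical K n (Sum.inr v)
        (galoisCohomology.localization (mu K n) (Sum.inr v) 2 c) =
        ψe (-ψ (absGaloisRestrict K (v.adicCompletion K) (WeilGroup.toAbsGalois (v.adicCompletion K) (wv v)))) := by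
      intro v _
      rw [LocalInvariants.canonical_inr, hc, hy,
        localInvariantMap_localization_cupProduct_δ₀_map_scalarCocycle h ψ Ψ hΨ _ v,
        localInvariantMap_localization_cupProduct_δ₀_eq_neg_apply L ψ hker bu v (wv v) (hwv v), hψe, hnd]
    rw [Finset.sum_congr rfl fun v hv => hterm v hv, ← map_sum] at hrec
    have hsum' := (injective_iff_map_eq_zero ψe).1 hψe_inj _ hrec
    rw [Finset.sum_neg_distrib, neg_eq_zero] at hsum'
    have hdvd' : d ∣ ∑ v ∈ T, (ψ (absGaloisRestrict K (v.adicCompletion K)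
        (WeilGroup.toAbsGalois (v.adicCompletion K) (wv v)))).val := by
      rw [← ZMod.natCast_eq_zero_iff, Nat.cast_sum]
      simpa only [ZMod.natCast_zmod_val] using hsum'
    -- the principal idèle of `b`: `(b) = ξ · ∏_{v ∈ S' ∖ Sf} ⟨b⟩_v · u`, `ψ_{L|K}(u) = 1`
    obtain ⟨S₀, hS₀⟩ := exists_map_unitIdelesOutside_le K (normClassGroup K L) (isOpen_normClassGroup' L)
    set S' : Finset (HeightOneSpectrum (𝓞 K)) := Sf ∪ S₀ ∪ T with hS'
    have hTS' : ∀ v ∉ S', Valued.v (algebraMap K (v.adicCompletion K) (bu : K)) = 1 := by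
      intro v hv
      have hvS : v ∉ Sf := fun h' => hv (Finset.mem_union_left _ (Finset.mem_union_left _ h'))
      have hvT : v ∉ T := fun h' => hv (Finset.mem_union_right _ h')
      exact hunit_of v hvS hvT
    obtain ⟨u, hu, hdec⟩ := principalIdele_mem_mul_unitIdelesOutside bu S' hTS'
    set A := artinIdeleMap L hR with hA
    have hAu : A u = 1 := by
      have hu' : u ∈ unitIdelesOutside K S₀ :=
        unitIdelesOutside_antitone (Finset.subset_union_right.trans Finset.subset_union_left) hu
      have hmem : QuotientGroup.mk' (principalIdeles K) u ∈ normClassGroup K L :=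
        hS₀ (Subgroup.mem_map_of_mem _ hu')
      rw [← ker_artinClassMap_eq L, MonoidHom.mem_ker, QuotientGroup.mk'_apply, artinClassMap_mk] at hmem
      exact hmem
    -- the commutative character `Φ = χ ∘ ψ_{L|K}`
    set Φ : ideleGroup K →* ℂˣ := χ.comp A with hΦ
    have hΦloc : ∀ v : HeightOneSpectrum (𝓞 K), Φ (localUnits v (globalToLocalUnits v bu)) =
        (ζ ^ (ψ (absGaloisRestrict K (v.adicCompletion K)
          (WeilGroup.toAbsGalois (v.adicCompletion K) (wv v)))).val)⁻¹ := fun v => by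
      rw [hΦ, MonoidHom.comp_apply, ← hwv v, hA, artinIdeleMap_localUnits_canonicalArtin_eq_inv L (wv v), map_inv,
        hval]
    have hsdiff : S' \ Sf ⊆ S' := Finset.sdiff_subset
    have hprod_rest : ∏ v ∈ S' \ Sf, Φ (localUnits v (globalToLocalUnits v bu)) = 1 := by
      -- the factors off `T` are `1` (units at unramified places), those on `T` multiply to `ζ^{d·k} = 1`
      have hsub : T ⊆ S' \ Sf := fun v hv => by
        rw [Finset.mem_sdiff]
        exact ⟨Finset.mem_union_right _ hv, ((hmemT v).mp hv).2⟩
      rw [← Finset.prod_subset hsub (fun v hv hvT => ?_)]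
      · rw [Finset.prod_congr rfl fun v _ => hΦloc v, Finset.prod_inv_distrib, Finset.prod_pow_eq_pow_sum,
          (hζ.pow_eq_one_iff_dvd _).mpr hdvd', inv_one]
      · have hvS : v ∉ Sf := (Finset.mem_sdiff.mp hv).2
        rw [hΦ, MonoidHom.comp_apply, hA, hunits v hvS _ (by rw [val_globalToLocalUnits]; exact hunit_of v hvS hvT),
          map_one]
    have hΦb : Φ (principalIdele K bu) = 1 := by
      rw [hΦ, MonoidHom.comp_apply, hA, artinIdeleMap_eq_one_of_mem_principalIdeles L hR (principalIdele_mem bu),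
        map_one]
    have hsplit : ∏ v ∈ S', localUnits v (globalToLocalUnits v bu) =
        ξf * ∏ v ∈ S' \ Sf, localUnits v (globalToLocalUnits v bu) := by
      have hSfS' : Sf ⊆ S' := Finset.subset_union_left.trans Finset.subset_union_left
      rw [hξf, ← Finset.prod_union Finset.disjoint_sdiff, Finset.union_sdiff_of_subset hSfS']
    have hΦu : Φ u = 1 := by rw [hΦ, MonoidHom.comp_apply, hAu, map_one]
    have hprod_rest' : Φ (∏ v ∈ S' \ Sf, localUnits v (globalToLocalUnits v bu)) = 1 := by
      rw [map_prod]; exact hprod_rest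
    rw [hdec, hsplit, map_mul, map_mul, map_mul, hprod_rest', mul_one, hΦu, mul_one, ← map_mul] at hΦb
    rw [hξ]
    exact hΦb
  -- §4. the global class `x = κ(a₀)`
  obtain ⟨a₀, u, yI, hu, hdec⟩ := hsep
  have hcomp : ∀ v : HeightOneSpectrum (𝓞 K), (ξ : AdeleRing (𝓞 K) K).2 v =
      algebraMap K (v.adicCompletion K) (a₀ : K) * (u : AdeleRing (𝓞 K) K).2 v *
        ((yI : AdeleRing (𝓞 K) K).2 v) ^ n := by
    intro v
    have h := congrArg (fun z : ideleGroup K => ideleGroup.finComp v z) hdec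
    simp only [map_mul, map_pow, ideleGroup.finComp_apply, principalIdele_snd] at h
    exact h
  have hcomp_inf : algebraMap K (InfiniteAdeleRing K) b =
      algebraMap K (InfiniteAdeleRing K) (a₀ : K) * ((yI : AdeleRing (𝓞 K) K).1) ^ n := by
    have h := congrArg (fun z : ideleGroup K => ideleGroup.infComp z) hdec
    simp only [map_mul, map_pow, ideleGroup.infComp_apply, principalIdele_fst, hu.1, mul_one] at h
    rw [hξfst] at h
    exact h
  refine ⟨(isSES_kummer K n (NeZero.pos n)).δ₀ (baseUnitsInvariant K (a₀ : K) a₀.ne_zero), fun v hv => ?_,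
    fun q hq => ?_⟩
  · -- unramified outside `S`: `a₀ ∈ 𝒪_vˣ · (K_vˣ)ⁿ` at `v ∉ Sf`
    have hvSf : v ∉ Sf := fun h => hv ((hmemSf v).mp h)
    have h1 := hcomp v
    rw [hξsnd, if_neg hvSf] at h1
    have hu0 : (u : AdeleRing (𝓞 K) K).2 v ≠ 0 := ideleGroup_snd_ne_zero u v
    have hy0 : (yI : AdeleRing (𝓞 K) K).2 v ≠ 0 := ideleGroup_snd_ne_zero yI v
    refine localization_kummer_mem_unramifiedSubgroup_of_eq_unit_mul_pow v (a₀ : K) a₀.ne_zero (hS v hv).1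
      ⟨(Units.mk0 _ hu0)⁻¹, ((yI : AdeleRing (𝓞 K) K).2 v)⁻¹, ?_, ?_⟩
    · rw [Units.val_inv_eq_inv_val, Units.val_mk0, map_inv₀, hu.2.2 v, inv_one]
    · rw [Units.val_inv_eq_inv_val, Units.val_mk0, inv_pow]
      have h2 : algebraMap K (v.adicCompletion K) (a₀ : K) *
          ((u : AdeleRing (𝓞 K) K).2 v * ((yI : AdeleRing (𝓞 K) K).2 v) ^ n) = 1 := by
        rw [← mul_assoc]; exact h1.symm
      rw [eq_inv_of_mul_eq_one_left h2, mul_inv]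
  · rcases q with w | v
    · -- infinite places: `b = a₀ · y_wⁿ` in `K_w`, so `loc_w κ(a₀) = loc_w κ(b) = t_w`
      rw [← hbt_inf w]
      have hw : algebraMap K w.Completion b =
          algebraMap K w.Completion (a₀ : K) * ((yI : AdeleRing (𝓞 K) K).1 w) ^ n := congrFun hcomp_inf w
      exact (localization_inl_kummer_eq_of_eq_mul_pow w (a₀ : K) b a₀.ne_zero hb0 hw).symm
    · -- finite places of `S`: `b = a₀ · yⁿ` in `K_v`
      have hvSf : v ∈ Sf := (hmemSf v).mpr hq
      have h1 := hcomp v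
      rw [hξsnd, if_pos hvSf, hu.2.1 v hvSf, mul_one] at h1
      rw [← hbt v hvSf]
      exact (localization_kummer_eq_of_eq_mul_pow v (a₀ : K) b a₀.ne_zero hb0 (ideleGroup_snd_ne_zero yI v) h1).symm

end Summit.BirchSwinnertonDyer.BirchSwinnertonDyer.Theorems.SignedEC.MuReal

end
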